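import Summits.CriticalPhenomena.PercolationContinuityZ3.Theorems.Transplant.FKConnectivityAllQAntipodalAnd3Triangle
import HarnessLib

/-!
# Connectivity correlation inequalities for `φ_{w,q}`, every `q > 0` — file 27: `C_∞` at level 3 for the PATH `S = P₄` — the SERIES JUNCTION
# IDENTITY (AND-drift of a 3-edge path across a one-point union = nonnegative combination of |W| = 3 AND-drifts and single-edge drifts of the sides)

Support file (`--supports stmt-CriticalPhenomena-4575`), FK sub-lane `prim-bschramm-fk-2` (gen 18) of the post-continuity programme; builds
on p205010 (kernel theorem, internal audit signed; external expert review pending).  No definitions, no named facts, no sorries; standard axioms.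

THE PROBLEM (FK-Q2 §26–27).  For a graph `N`, a set `S` of extra edges and a test function `g` on the configurations of `N`, the AND-DRIFT is
`a_S(g) = ∑_{γ ⊆ N} 𝔞(γ) g(γ)`, `𝔞(γ) = q^{k(γ ∪ S) + k(N \ γ)} - q^{k((N \ γ) ∪ S) + k(γ)}` (`k` = free cluster count on all of `V`); for `g`
increasing and not reading `S`, `apPsi q (N ∪ S) 1_{S ⊆ ·} g = 2 a_S(g)` (gen 17, `…And3Triangle`), so gen 10's Conjecture `C_∞` for the AND type
`f = 1_{S ⊆ ω}` is `a_S(g) ≤ 0` (`0 < q ≤ 1`).  |S| = 1 is Theorem U (`…AntipodalUpc`), |S| = 2 is gen 11's `apPsi_two_edges_nonpos`; |S| = 3 with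
`S = P₄ = {ab, bc, cd}` is the first open case (the AND-drift is an extreme odd type, not a combination of the smaller ones on the SAME graph).
THIS FILE: the SERIES CASE of the junction reduction found by gen 18 (memo `bschramm/FROM-fk-2-g18-AND-WORDHALL.md` §7A).  Let `N = N₁ ⊔ N₂` with
the two parts supported on vertex sets `V₁, V₂` meeting only in `m`, `a, b` on side 1 (`b ∉ V₂`), `c, d` on side 2 (`c ∉ V₁`).  For
`γ = γ₁ ⊔ γ₂` write `ω₁ = γ₁ ∪ {ab}`, `ω̄₁ = (N₁\γ₁) ∪ {ab}`, `L₁ = k(ω₁)+k(N₁\γ₁)`, `L̄₁ = k(ω̄₁)+k(γ₁)`, `Y₁ = k(ω₁ ∪ {bm})+k(N₁\γ₁)`,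
`Ȳ₁ = k(ω̄₁ ∪ {bm})+k(γ₁)`, `s₁ = 1{b ↮ m in ω₁}` and side 2 alike with `cd`, `mc`, `s̄₂ = 1{m ↮ c in ω̄₂}`.  Then (`and4_summand_series`)
`q^{2|V|+1} 𝔞(γ) = (1-s̄₂) q^{L̄₂+1}(q^{Y₁} - q^{Ȳ₁}) + s̄₂ q^{L̄₂}(q^{L₁} - q^{L̄₁}) + (1-s₁) q^{L₁+1}(q^{Y₂} - q^{Ȳ₂}) + s₁ q^{L₁}(q^{L₂} - q^{L̄₂})`
— `q^{Y₁} - q^{Ȳ₁}` is the |W| = 3 AND-coefficient of side 1 for the path `a–b–m`, `q^{L₁} - q^{L̄₁}` the single-edge (Theorem U) coefficient for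
`ab`; all four multipliers are NONNEGATIVE and depend only on the OTHER side.  Ingredients: `clusterCount_series` / `reachable_series_iff`
(gen 7's gluing), the edge-insertion identity, and a sixteen-case `ring` computation (in the variables `x_i = q^{-[outer ≁ hub]}`, `y_i = q^{-s_i}`
the composite merge count is `u₁ + u₂ + (s₁ ∨ s₂)` and the identity is `x̄₁x̄₂ȳ₁₂ - x₁x₂y₁₂ = x̄₂(s̄₂ r(x̄₁-x₁) + (1-s̄₂)(x̄₁ȳ₁-x₁y₁)) + x₁(s₁ r(x̄₂-x₂)
+ (1-s₁)(x̄₂ȳ₂-x₂y₂))`, `r = 1/q`; found by a junction LP and verified exactly on configurations before typing).  Summing (`and4_series_eq`) gives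
**`and4_series_nonpos`**: if the |W| = 3 AND-drift for `(a,b,m)` and the `ab`-drift are `≤ 0` on every monotone test function on side 1, and
likewise for `(d,c,m)` and `cd` on side 2, then `a_S(g) ≤ 0` for `S = {ab, bc, cd}` and every monotone `g` on `N` (`q > 0`).  With gen 11's kernel
theorems as inputs (`apPsi_two_edges_nonpos_of_isTTSP`, `apPsi_mem_edge_nonpos_of_isTTSP`) this is `C_∞(and_{P₄})` for every series–parallel `H ⊇ P₄`
whose middle-edge complement `H \ bc` is a SERIES composition `A′(b,m)·A″(m,c)` — the bridge to the `apPsi` form is left to the sibling file.  The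
parallel junction (two parts meeting in `{b,c}`) has the analogous identity with Theorem U on the `bc`-contracted sides (`apUpcC`) — memo §7A.
[cite: Grimmett2006, §1.4 eq. (1.20) (p. 15); §3.8 Thm. (3.90) (pp. 61–62); §3.9 (pp. 63–64)] [cite: Wagner2006, Thm. 5.8(d), §5.3]
-/

noncomputable section

namespace Summit.CriticalPhenomena.PercolationContinuityZ3.Theorems

namespace FK

open SimpleGraph Literature.Probability.LatticeModels Literature.Probability.Percolation
open scoped Classical

variable {V : Type*} [Fintype V]

/-! ### Bookkeeping -/

/-- Inserting the pair `uv` lowers the free cluster count by `1{u ↮ v}`. [cite: Grimmett2006, §1.4 eq. (1.20) (p. 15)] -/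
theorem clusterCount_insert_add_ite (X : Finset (Sym2 V)) (u v : V) :
    clusterCount (↑(insert s(u, v) X) : BondConfig V) ∅ +
        (if (openGraph (↑X : BondConfig V)).Reachable u v then 0 else 1) = clusterCount (↑X : BondConfig V) ∅ := by
  have key := clusterCount_union_pair_add (↑X : BondConfig V) u v
  rw [Finset.coe_insert, Set.insert_eq, Set.union_comm]
  exact key

section Series

variable {E₁ E₂ : Finset (Sym2 V)} {V₁ V₂ : Set V} {a b m c d : V}

/-- **Series junction, the exponent of the `S`-side.**  For `X ⊆ E₁`, `Y ⊆ E₂` (the parts meeting only in `m`; `a, b ∈ V₁ \ V₂`,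
`c, d ∈ V₂ \ V₁`): `k(X ∪ Y ∪ {ab, bc, cd}) + |V| + 1 = k(X ∪ {ab}) + k(Y ∪ {cd}) + 1{b ↔ m in X ∪ {ab} and m ↔ c in Y ∪ {cd}}`.
[cite: Grimmett2006, §3.8 (pp. 61–62)] -/
theorem clusterCount_junction_series (h₁ : ∀ e ∈ (↑E₁ : Set (Sym2 V)), ∀ z ∈ e, z ∈ V₁)
    (h₂ : ∀ e ∈ (↑E₂ : Set (Sym2 V)), ∀ z ∈ e, z ∈ V₂) (hS : V₁ ∩ V₂ ⊆ {m}) (hbV₂ : b ∉ V₂) (hcV₁ : c ∉ V₁)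
    (hbm : b ≠ m) (hcm : c ≠ m) (hbc : b ≠ c) (hab₁ : s(a, b) ∈ E₁) (hcd₂ : s(c, d) ∈ E₂)
    {X Y : Finset (Sym2 V)} (hX : X ⊆ E₁) (hY : Y ⊆ E₂) :
    clusterCount (↑(insert s(b, c) (insert s(a, b) X ∪ insert s(c, d) Y)) : BondConfig V) ∅ + Fintype.card V + 1 =
      clusterCount (↑(insert s(a, b) X) : BondConfig V) ∅ + clusterCount (↑(insert s(c, d) Y) : BondConfig V) ∅ +
        (if (openGraph (↑(insert s(a, b) X) : BondConfig V)).Reachable b m ∧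
            (openGraph (↑(insert s(c, d) Y) : BondConfig V)).Reachable m c then 1 else 0) := by
  have hX' : insert s(a, b) X ⊆ E₁ := Finset.insert_subset hab₁ hX
  have hY' : insert s(c, d) Y ⊆ E₂ := Finset.insert_subset hcd₂ hY
  have kser := clusterCount_series (ω₁ := (↑(insert s(a, b) X) : Set (Sym2 V))) (ω₂ := (↑(insert s(c, d) Y) : Set (Sym2 V)))
    h₁ h₂ hS (Finset.coe_subset.2 hX') (Finset.coe_subset.2 hY')
  have kins := clusterCount_insert_add_ite (insert s(a, b) X ∪ insert s(c, d) Y) b c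
  have hreach : (openGraph (↑(insert s(a, b) X ∪ insert s(c, d) Y) : BondConfig V)).Reachable b c ↔
      (openGraph (↑(insert s(a, b) X) : BondConfig V)).Reachable b m ∧
        (openGraph (↑(insert s(c, d) Y) : BondConfig V)).Reachable m c := by
    rw [Finset.coe_union]
    exact reachable_series_iff h₁ h₂ hS (Finset.coe_subset.2 hX') (Finset.coe_subset.2 hY') hbV₂ hcV₁ hbm hcm hbc
  by_cases hr : (openGraph (↑(insert s(a, b) X) : BondConfig V)).Reachable b m ∧
      (openGraph (↑(insert s(c, d) Y) : BondConfig V)).Reachable m c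
  · rw [if_pos (hreach.2 hr)] at kins
    rw [Finset.coe_union] at kins
    rw [if_pos hr]
    omega
  · rw [if_neg (fun h => hr (hreach.1 h))] at kins
    rw [Finset.coe_union] at kins
    rw [if_neg hr]
    omega

/-- **Series junction, the exponent of the free side**: `k(X ∪ Y) + |V| = k(X) + k(Y)`. [cite: Grimmett2006, §3.8 (pp. 61–62)] -/
theorem clusterCount_union_series (h₁ : ∀ e ∈ (↑E₁ : Set (Sym2 V)), ∀ z ∈ e, z ∈ V₁)
    (h₂ : ∀ e ∈ (↑E₂ : Set (Sym2 V)), ∀ z ∈ e, z ∈ V₂) (hS : V₁ ∩ V₂ ⊆ {m}) {X Y : Finset (Sym2 V)} (hX : X ⊆ E₁) (hY : Y ⊆ E₂) :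
    clusterCount (↑(X ∪ Y) : BondConfig V) ∅ + Fintype.card V =
      clusterCount (↑X : BondConfig V) ∅ + clusterCount (↑Y : BondConfig V) ∅ := by
  have kser := clusterCount_series (ω₁ := (↑X : Set (Sym2 V))) (ω₂ := (↑Y : Set (Sym2 V))) h₁ h₂ hS
    (Finset.coe_subset.2 hX) (Finset.coe_subset.2 hY)
  rw [Finset.coe_union]; exact kser

set_option linter.unusedSimpArgs false in
/-- **THE SERIES JUNCTION IDENTITY (pointwise).**  With `ω₁ = γ₁ ∪ {ab}`, `ω̄₁ = γ₁ᶜ ∪ {ab}`, `ω₂ = γ₂ ∪ {cd}`, `ω̄₂ = γ₂ᶜ ∪ {cd}`,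
`L₁ = k(ω₁) + k(γ₁ᶜ)`, `L̄₁ = k(ω̄₁) + k(γ₁)`, `Y₁ = k(ω₁ ∪ {bm}) + k(γ₁ᶜ)`, `Ȳ₁ = k(ω̄₁ ∪ {bm}) + k(γ₁)` (side 2 alike with `mc`), and
`s̄₂ = 1{m ↮ c in ω̄₂}`, `s₁ = 1{b ↮ m in ω₁}`:
`q^{2|V|+1} (q^{k(γ∪S)+k(γᶜ)} - q^{k(γᶜ∪S)+k(γ)}) = (1-s̄₂) q^{L̄₂+1} (q^{Y₁} - q^{Ȳ₁}) + s̄₂ q^{L̄₂} (q^{L₁} - q^{L̄₁})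
  + (1-s₁) q^{L₁+1} (q^{Y₂} - q^{Ȳ₂}) + s₁ q^{L₁} (q^{L₂} - q^{L̄₂})` — four cases in `(s₁, s̄₂)`.
[cite: Grimmett2006, §3.8 (pp. 61–62)] -/
theorem and4_summand_series (q : ℝ) (h₁ : ∀ e ∈ (↑E₁ : Set (Sym2 V)), ∀ z ∈ e, z ∈ V₁)
    (h₂ : ∀ e ∈ (↑E₂ : Set (Sym2 V)), ∀ z ∈ e, z ∈ V₂) (hS : V₁ ∩ V₂ ⊆ {m}) (hbV₂ : b ∉ V₂) (hcV₁ : c ∉ V₁)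
    (hbm : b ≠ m) (hcm : c ≠ m) (hbc : b ≠ c) (hab₁ : s(a, b) ∈ E₁) (hcd₂ : s(c, d) ∈ E₂)
    {N₁ N₂ γ₁ γ₂ : Finset (Sym2 V)} (hN₁ : N₁ ⊆ E₁) (hN₂ : N₂ ⊆ E₂) (hγ₁ : γ₁ ⊆ N₁) (hγ₂ : γ₂ ⊆ N₂) (x : ℝ) :
    q ^ (2 * Fintype.card V + 1) *
        ((q ^ (clusterCount (↑(insert s(b, c) (insert s(a, b) γ₁ ∪ insert s(c, d) γ₂)) : BondConfig V) ∅ +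
              clusterCount (↑((N₁ \ γ₁) ∪ (N₂ \ γ₂)) : BondConfig V) ∅) -
          q ^ (clusterCount (↑(insert s(b, c) (insert s(a, b) (N₁ \ γ₁) ∪ insert s(c, d) (N₂ \ γ₂))) : BondConfig V) ∅ +
              clusterCount (↑(γ₁ ∪ γ₂) : BondConfig V) ∅)) * x) =
      (if (openGraph (↑(insert s(c, d) (N₂ \ γ₂)) : BondConfig V)).Reachable m c then 1 else 0) * q ^ (clusterCount (↑(insert s(c, d) (N₂ \ γ₂)) : BondConfig V) ∅ + clusterCount (↑γ₂ : BondConfig V) ∅ + 1) *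
          ((q ^ (clusterCount (↑(insert s(b, m) (insert s(a, b) γ₁)) : BondConfig V) ∅ + clusterCount (↑(N₁ \ γ₁) : BondConfig V) ∅) - q ^ (clusterCount (↑(insert s(b, m) (insert s(a, b) (N₁ \ γ₁))) : BondConfig V) ∅ + clusterCount (↑γ₁ : BondConfig V) ∅)) * x) +
      (if (openGraph (↑(insert s(c, d) (N₂ \ γ₂)) : BondConfig V)).Reachable m c then 0 else 1) * q ^ (clusterCount (↑(insert s(c, d) (N₂ \ γ₂)) : BondConfig V) ∅ + clusterCount (↑γ₂ : BondConfig V) ∅) *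
          ((q ^ (clusterCount (↑(insert s(a, b) γ₁) : BondConfig V) ∅ + clusterCount (↑(N₁ \ γ₁) : BondConfig V) ∅) - q ^ (clusterCount (↑(insert s(a, b) (N₁ \ γ₁)) : BondConfig V) ∅ + clusterCount (↑γ₁ : BondConfig V) ∅)) * x) +
      (if (openGraph (↑(insert s(a, b) γ₁) : BondConfig V)).Reachable b m then 1 else 0) * q ^ (clusterCount (↑(insert s(a, b) γ₁) : BondConfig V) ∅ + clusterCount (↑(N₁ \ γ₁) : BondConfig V) ∅ + 1) *
          ((q ^ (clusterCount (↑(insert s(m, c) (insert s(c, d) γ₂)) : BondConfig V) ∅ + clusterCount (↑(N₂ \ γ₂) : BondConfig V) ∅) - q ^ (clusterCount (↑(insert s(m, c) (insert s(c, d) (N₂ \ γ₂))) : BondConfig V) ∅ + clusterCount (↑γ₂ : BondConfig V) ∅)) * x) +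
      (if (openGraph (↑(insert s(a, b) γ₁) : BondConfig V)).Reachable b m then 0 else 1) * q ^ (clusterCount (↑(insert s(a, b) γ₁) : BondConfig V) ∅ + clusterCount (↑(N₁ \ γ₁) : BondConfig V) ∅) *
          ((q ^ (clusterCount (↑(insert s(c, d) γ₂) : BondConfig V) ∅ + clusterCount (↑(N₂ \ γ₂) : BondConfig V) ∅) - q ^ (clusterCount (↑(insert s(c, d) (N₂ \ γ₂)) : BondConfig V) ∅ + clusterCount (↑γ₂ : BondConfig V) ∅)) * x) := by
  -- bookkeeping for the four exponents of the left-hand side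
  have eS := clusterCount_junction_series h₁ h₂ hS hbV₂ hcV₁ hbm hcm hbc hab₁ hcd₂ (hγ₁.trans hN₁) (hγ₂.trans hN₂)
  have eSb := clusterCount_junction_series h₁ h₂ hS hbV₂ hcV₁ hbm hcm hbc hab₁ hcd₂
    (Finset.sdiff_subset.trans hN₁) (Finset.sdiff_subset.trans hN₂) (X := N₁ \ γ₁) (Y := N₂ \ γ₂)
  have eC := clusterCount_union_series h₁ h₂ hS (Finset.sdiff_subset.trans hN₁) (Finset.sdiff_subset.trans hN₂)
    (X := N₁ \ γ₁) (Y := N₂ \ γ₂)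
  have eG := clusterCount_union_series h₁ h₂ hS (hγ₁.trans hN₁) (hγ₂.trans hN₂) (X := γ₁) (Y := γ₂)
  -- the pendant terminal edges `bm`, `cm`
  have y₁ := clusterCount_insert_add_ite (insert s(a, b) γ₁) b m
  have yb₁ := clusterCount_insert_add_ite (insert s(a, b) (N₁ \ γ₁)) b m
  have y₂ := clusterCount_insert_add_ite (insert s(c, d) γ₂) m c
  have yb₂ := clusterCount_insert_add_ite (insert s(c, d) (N₂ \ γ₂)) m c
  -- abbreviate the atoms
  set KS := clusterCount (↑(insert s(b, c) (insert s(a, b) γ₁ ∪ insert s(c, d) γ₂)) : BondConfig V) ∅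
  set KSb := clusterCount (↑(insert s(b, c) (insert s(a, b) (N₁ \ γ₁) ∪ insert s(c, d) (N₂ \ γ₂))) : BondConfig V) ∅
  set KC := clusterCount (↑((N₁ \ γ₁) ∪ (N₂ \ γ₂)) : BondConfig V) ∅
  set KG := clusterCount (↑(γ₁ ∪ γ₂) : BondConfig V) ∅
  set A₁ := clusterCount (↑(insert s(a, b) γ₁) : BondConfig V) ∅
  set Ab₁ := clusterCount (↑(insert s(a, b) (N₁ \ γ₁)) : BondConfig V) ∅
  set A₂ := clusterCount (↑(insert s(c, d) γ₂) : BondConfig V) ∅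
  set Ab₂ := clusterCount (↑(insert s(c, d) (N₂ \ γ₂)) : BondConfig V) ∅
  set G₁ := clusterCount (↑γ₁ : BondConfig V) ∅
  set Gb₁ := clusterCount (↑(N₁ \ γ₁) : BondConfig V) ∅
  set G₂ := clusterCount (↑γ₂ : BondConfig V) ∅
  set Gb₂ := clusterCount (↑(N₂ \ γ₂) : BondConfig V) ∅
  set Y₁ := clusterCount (↑(insert s(b, m) (insert s(a, b) γ₁)) : BondConfig V) ∅
  set Yb₁ := clusterCount (↑(insert s(b, m) (insert s(a, b) (N₁ \ γ₁))) : BondConfig V) ∅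
  set Y₂ := clusterCount (↑(insert s(m, c) (insert s(c, d) γ₂)) : BondConfig V) ∅
  set Yb₂ := clusterCount (↑(insert s(m, c) (insert s(c, d) (N₂ \ γ₂))) : BondConfig V) ∅
  -- the left-hand side as one power
  have lhs1 : q ^ (2 * Fintype.card V + 1) * q ^ (KS + KC) = q ^ (KS + Fintype.card V + 1 + (KC + Fintype.card V)) := by
    rw [← pow_add]; congr 1; omega
  have lhs2 : q ^ (2 * Fintype.card V + 1) * q ^ (KSb + KG) = q ^ (KSb + Fintype.card V + 1 + (KG + Fintype.card V)) := by
    rw [← pow_add]; congr 1; omega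
  have expand : q ^ (2 * Fintype.card V + 1) * ((q ^ (KS + KC) - q ^ (KSb + KG)) * x) =
      (q ^ (KS + Fintype.card V + 1 + (KC + Fintype.card V)) - q ^ (KSb + Fintype.card V + 1 + (KG + Fintype.card V))) * x := by
    rw [← lhs1, ← lhs2]; ring
  rw [expand, eS, eSb, eC, eG]
  by_cases r₁ : (openGraph (↑(insert s(a, b) γ₁) : BondConfig V)).Reachable b m <;>
  by_cases rb₁ : (openGraph (↑(insert s(a, b) (N₁ \ γ₁)) : BondConfig V)).Reachable b m <;>
  by_cases r₂ : (openGraph (↑(insert s(c, d) γ₂) : BondConfig V)).Reachable m c <;>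
  by_cases rb₂ : (openGraph (↑(insert s(c, d) (N₂ \ γ₂)) : BondConfig V)).Reachable m c <;>
  simp only [r₁, rb₁, r₂, rb₂, and_self, and_true, true_and, and_false, false_and, if_true, if_false,
    not_false_eq_true, not_true_eq_false, add_zero] at y₁ yb₁ y₂ yb₂ ⊢ <;>
  (rw [← y₁, ← yb₁, ← y₂, ← yb₂]; ring)

omit [Fintype V] in
/-- The AND configuration of the junction: `(X ∪ Y) ∪ {ab, bc, cd} = (X ∪ {ab}) ∪ (Y ∪ {cd}) ∪ {bc}` as finsets. [folklore] -/
theorem union_path3_eq (X Y : Finset (Sym2 V)) (a b c d : V) :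
    X ∪ Y ∪ {s(a, b), s(b, c), s(c, d)} = insert s(b, c) (insert s(a, b) X ∪ insert s(c, d) Y) := by
  ext e
  simp only [Finset.mem_union, Finset.mem_insert, Finset.mem_singleton]
  tauto

/-- **THE SERIES JUNCTION IDENTITY (summed).**  For `N = N₁ ⊔ N₂` glued at `m` and `S = {ab, bc, cd}`:
`q^{2|V|+1} · ∑_{γ ⊆ N} (q^{k(γ∪S)+k(N\γ)} - q^{k((N\γ)∪S)+k(γ)}) g(γ)` is the sum over `γ₂ ⊆ N₂` of nonnegative multiples of the side-1
functionals `∑_{γ₁} (q^{Y₁} - q^{Ȳ₁}) g(γ₁ ∪ γ₂)` (|W| = 3 AND for `a, b, m`) and `∑_{γ₁} (q^{L₁} - q^{L̄₁}) g(γ₁ ∪ γ₂)` (Theorem U for `ab`),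
plus the mirror terms. [cite: Grimmett2006, §3.8 Thm. (3.90) (pp. 61–62)] -/
theorem and4_series_eq (q : ℝ) (h₁ : ∀ e ∈ (↑E₁ : Set (Sym2 V)), ∀ z ∈ e, z ∈ V₁)
    (h₂ : ∀ e ∈ (↑E₂ : Set (Sym2 V)), ∀ z ∈ e, z ∈ V₂) (hS : V₁ ∩ V₂ ⊆ {m}) (hbV₂ : b ∉ V₂) (hcV₁ : c ∉ V₁)
    (hbm : b ≠ m) (hcm : c ≠ m) (hbc : b ≠ c) (hab₁ : s(a, b) ∈ E₁) (hcd₂ : s(c, d) ∈ E₂)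
    {N₁ N₂ : Finset (Sym2 V)} (hd : Disjoint N₁ N₂) (hN₁ : N₁ ⊆ E₁) (hN₂ : N₂ ⊆ E₂) (g : Finset (Sym2 V) → ℝ) :
    q ^ (2 * Fintype.card V + 1) *
        ∑ γ ∈ (N₁ ∪ N₂).powerset,
          (q ^ (clusterCount (↑(γ ∪ {s(a, b), s(b, c), s(c, d)}) : BondConfig V) ∅ + clusterCount (↑((N₁ ∪ N₂) \ γ) : BondConfig V) ∅) -
              q ^ (clusterCount (↑((N₁ ∪ N₂) \ γ ∪ {s(a, b), s(b, c), s(c, d)}) : BondConfig V) ∅ + clusterCount (↑γ : BondConfig V) ∅)) * g γ =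
      ∑ γ₂ ∈ N₂.powerset,
          ((if (openGraph (↑(insert s(c, d) (N₂ \ γ₂)) : BondConfig V)).Reachable m c then 1 else 0) * q ^ (clusterCount (↑(insert s(c, d) (N₂ \ γ₂)) : BondConfig V) ∅ + clusterCount (↑γ₂ : BondConfig V) ∅ + 1) *
              ∑ γ₁ ∈ N₁.powerset, (q ^ (clusterCount (↑(insert s(b, m) (insert s(a, b) γ₁)) : BondConfig V) ∅ + clusterCount (↑(N₁ \ γ₁) : BondConfig V) ∅) - q ^ (clusterCount (↑(insert s(b, m) (insert s(a, b) (N₁ \ γ₁))) : BondConfig V) ∅ + clusterCount (↑γ₁ : BondConfig V) ∅)) * g (γ₁ ∪ γ₂) +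
            (if (openGraph (↑(insert s(c, d) (N₂ \ γ₂)) : BondConfig V)).Reachable m c then 0 else 1) * q ^ (clusterCount (↑(insert s(c, d) (N₂ \ γ₂)) : BondConfig V) ∅ + clusterCount (↑γ₂ : BondConfig V) ∅) *
              ∑ γ₁ ∈ N₁.powerset, (q ^ (clusterCount (↑(insert s(a, b) γ₁) : BondConfig V) ∅ + clusterCount (↑(N₁ \ γ₁) : BondConfig V) ∅) - q ^ (clusterCount (↑(insert s(a, b) (N₁ \ γ₁)) : BondConfig V) ∅ + clusterCount (↑γ₁ : BondConfig V) ∅)) * g (γ₁ ∪ γ₂)) +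
        ∑ γ₁ ∈ N₁.powerset,
          ((if (openGraph (↑(insert s(a, b) γ₁) : BondConfig V)).Reachable b m then 1 else 0) * q ^ (clusterCount (↑(insert s(a, b) γ₁) : BondConfig V) ∅ + clusterCount (↑(N₁ \ γ₁) : BondConfig V) ∅ + 1) *
              ∑ γ₂ ∈ N₂.powerset, (q ^ (clusterCount (↑(insert s(m, c) (insert s(c, d) γ₂)) : BondConfig V) ∅ + clusterCount (↑(N₂ \ γ₂) : BondConfig V) ∅) - q ^ (clusterCount (↑(insert s(m, c) (insert s(c, d) (N₂ \ γ₂))) : BondConfig V) ∅ + clusterCount (↑γ₂ : BondConfig V) ∅)) * g (γ₁ ∪ γ₂) +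
            (if (openGraph (↑(insert s(a, b) γ₁) : BondConfig V)).Reachable b m then 0 else 1) * q ^ (clusterCount (↑(insert s(a, b) γ₁) : BondConfig V) ∅ + clusterCount (↑(N₁ \ γ₁) : BondConfig V) ∅) *
              ∑ γ₂ ∈ N₂.powerset, (q ^ (clusterCount (↑(insert s(c, d) γ₂) : BondConfig V) ∅ + clusterCount (↑(N₂ \ γ₂) : BondConfig V) ∅) - q ^ (clusterCount (↑(insert s(c, d) (N₂ \ γ₂)) : BondConfig V) ∅ + clusterCount (↑γ₂ : BondConfig V) ∅)) * g (γ₁ ∪ γ₂)) := by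
  rw [Finset.mul_sum, sum_powerset_union_disj hd]
  simp_rw [Finset.mul_sum, ← Finset.sum_add_distrib]
  rw [Finset.sum_comm (s := N₂.powerset) (t := N₁.powerset), ← Finset.sum_add_distrib]
  refine Finset.sum_congr rfl fun γ₁ hγ₁ => ?_
  rw [← Finset.sum_add_distrib]
  refine Finset.sum_congr rfl fun γ₂ hγ₂ => ?_
  rw [Finset.mem_powerset] at hγ₁ hγ₂
  rw [union_sdiff_union hd hγ₁ hγ₂, union_path3_eq, union_path3_eq,
    and4_summand_series q h₁ h₂ hS hbV₂ hcV₁ hbm hcm hbc hab₁ hcd₂ hN₁ hN₂ hγ₁ hγ₂ (g (γ₁ ∪ γ₂))]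
  ring

/-- **AND for a 3-edge path across a series junction (abstract form).**  If on side 1 the |W| = 3 AND-drift for `(a, b, m)` and the
single-edge drift for `ab` are `≤ 0` on every monotone test function, and likewise on side 2 for `(d, c, m)` and `cd`, then the AND-drift of
`S = {ab, bc, cd}` on `N = N₁ ⊔ N₂` is `≤ 0` on every monotone `g` (`q > 0`). [cite: Grimmett2006, §3.8 Thm. (3.90) (pp. 61–62)] -/
theorem and4_series_nonpos {q : ℝ} (hq : 0 < q) (h₁ : ∀ e ∈ (↑E₁ : Set (Sym2 V)), ∀ z ∈ e, z ∈ V₁)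
    (h₂ : ∀ e ∈ (↑E₂ : Set (Sym2 V)), ∀ z ∈ e, z ∈ V₂) (hS : V₁ ∩ V₂ ⊆ {m}) (hbV₂ : b ∉ V₂) (hcV₁ : c ∉ V₁)
    (hbm : b ≠ m) (hcm : c ≠ m) (hbc : b ≠ c) (hab₁ : s(a, b) ∈ E₁) (hcd₂ : s(c, d) ∈ E₂)
    {N₁ N₂ : Finset (Sym2 V)} (hd : Disjoint N₁ N₂) (hN₁ : N₁ ⊆ E₁) (hN₂ : N₂ ⊆ E₂)
    (hY₁ : ∀ h' : Finset (Sym2 V) → ℝ, (∀ ⦃A B : Finset (Sym2 V)⦄, A ⊆ B → B ⊆ N₁ → h' A ≤ h' B) →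
      ∑ γ₁ ∈ N₁.powerset, (q ^ (clusterCount (↑(insert s(b, m) (insert s(a, b) γ₁)) : BondConfig V) ∅ + clusterCount (↑(N₁ \ γ₁) : BondConfig V) ∅) - q ^ (clusterCount (↑(insert s(b, m) (insert s(a, b) (N₁ \ γ₁))) : BondConfig V) ∅ + clusterCount (↑γ₁ : BondConfig V) ∅)) * h' γ₁ ≤ 0)
    (hU₁ : ∀ h' : Finset (Sym2 V) → ℝ, (∀ ⦃A B : Finset (Sym2 V)⦄, A ⊆ B → B ⊆ N₁ → h' A ≤ h' B) →
      ∑ γ₁ ∈ N₁.powerset, (q ^ (clusterCount (↑(insert s(a, b) γ₁) : BondConfig V) ∅ + clusterCount (↑(N₁ \ γ₁) : BondConfig V) ∅) - q ^ (clusterCount (↑(insert s(a, b) (N₁ \ γ₁)) : BondConfig V) ∅ + clusterCount (↑γ₁ : BondConfig V) ∅)) * h' γ₁ ≤ 0)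
    (hY₂ : ∀ h' : Finset (Sym2 V) → ℝ, (∀ ⦃A B : Finset (Sym2 V)⦄, A ⊆ B → B ⊆ N₂ → h' A ≤ h' B) →
      ∑ γ₂ ∈ N₂.powerset, (q ^ (clusterCount (↑(insert s(m, c) (insert s(c, d) γ₂)) : BondConfig V) ∅ + clusterCount (↑(N₂ \ γ₂) : BondConfig V) ∅) - q ^ (clusterCount (↑(insert s(m, c) (insert s(c, d) (N₂ \ γ₂))) : BondConfig V) ∅ + clusterCount (↑γ₂ : BondConfig V) ∅)) * h' γ₂ ≤ 0)
    (hU₂ : ∀ h' : Finset (Sym2 V) → ℝ, (∀ ⦃A B : Finset (Sym2 V)⦄, A ⊆ B → B ⊆ N₂ → h' A ≤ h' B) →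
      ∑ γ₂ ∈ N₂.powerset, (q ^ (clusterCount (↑(insert s(c, d) γ₂) : BondConfig V) ∅ + clusterCount (↑(N₂ \ γ₂) : BondConfig V) ∅) - q ^ (clusterCount (↑(insert s(c, d) (N₂ \ γ₂)) : BondConfig V) ∅ + clusterCount (↑γ₂ : BondConfig V) ∅)) * h' γ₂ ≤ 0)
    {g : Finset (Sym2 V) → ℝ} (hmono : ∀ ⦃A B : Finset (Sym2 V)⦄, A ⊆ B → B ⊆ N₁ ∪ N₂ → g A ≤ g B) :
    ∑ γ ∈ (N₁ ∪ N₂).powerset,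
        (q ^ (clusterCount (↑(γ ∪ {s(a, b), s(b, c), s(c, d)}) : BondConfig V) ∅ + clusterCount (↑((N₁ ∪ N₂) \ γ) : BondConfig V) ∅) -
            q ^ (clusterCount (↑((N₁ ∪ N₂) \ γ ∪ {s(a, b), s(b, c), s(c, d)}) : BondConfig V) ∅ + clusterCount (↑γ : BondConfig V) ∅)) * g γ ≤ 0 := by
  have hpos : 0 < q ^ (2 * Fintype.card V + 1) := pow_pos hq _
  have key := and4_series_eq q h₁ h₂ hS hbV₂ hcV₁ hbm hcm hbc hab₁ hcd₂ hd hN₁ hN₂ g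
  suffices hle : q ^ (2 * Fintype.card V + 1) *
      ∑ γ ∈ (N₁ ∪ N₂).powerset,
        (q ^ (clusterCount (↑(γ ∪ {s(a, b), s(b, c), s(c, d)}) : BondConfig V) ∅ + clusterCount (↑((N₁ ∪ N₂) \ γ) : BondConfig V) ∅) -
            q ^ (clusterCount (↑((N₁ ∪ N₂) \ γ ∪ {s(a, b), s(b, c), s(c, d)}) : BondConfig V) ∅ + clusterCount (↑γ : BondConfig V) ∅)) * g γ ≤ 0 by
    by_contra hcon
    exact absurd hle (not_le.2 (mul_pos hpos (not_le.1 hcon)))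
  rw [key]
  have sec₁ : ∀ γ₂ ∈ N₂.powerset, ∀ ⦃A B : Finset (Sym2 V)⦄, A ⊆ B → B ⊆ N₁ → g (A ∪ γ₂) ≤ g (B ∪ γ₂) := by
    intro γ₂ hγ₂ A B hAB hB
    rw [Finset.mem_powerset] at hγ₂
    exact hmono (Finset.union_subset_union hAB le_rfl) (Finset.union_subset_union hB hγ₂)
  have sec₂ : ∀ γ₁ ∈ N₁.powerset, ∀ ⦃A B : Finset (Sym2 V)⦄, A ⊆ B → B ⊆ N₂ → g (γ₁ ∪ A) ≤ g (γ₁ ∪ B) := by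
    intro γ₁ hγ₁ A B hAB hB
    rw [Finset.mem_powerset] at hγ₁
    exact hmono (Finset.union_subset_union le_rfl hAB) (Finset.union_subset_union hγ₁ hB)
  refine add_nonpos (Finset.sum_nonpos fun γ₂ hγ₂ => ?_) (Finset.sum_nonpos fun γ₁ hγ₁ => ?_)
  · have i₁ := hY₁ (fun γ₁ => g (γ₁ ∪ γ₂)) (sec₁ γ₂ hγ₂)
    have i₂ := hU₁ (fun γ₁ => g (γ₁ ∪ γ₂)) (sec₁ γ₂ hγ₂)
    refine add_nonpos (mul_nonpos_of_nonneg_of_nonpos (mul_nonneg ?_ (pow_nonneg hq.le _)) i₁)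
      (mul_nonpos_of_nonneg_of_nonpos (mul_nonneg ?_ (pow_nonneg hq.le _)) i₂) <;>
    split_ifs <;> norm_num
  · have i₁ := hY₂ (fun γ₂ => g (γ₁ ∪ γ₂)) (sec₂ γ₁ hγ₁)
    have i₂ := hU₂ (fun γ₂ => g (γ₁ ∪ γ₂)) (sec₂ γ₁ hγ₁)
    refine add_nonpos (mul_nonpos_of_nonneg_of_nonpos (mul_nonneg ?_ (pow_nonneg hq.le _)) i₁)
      (mul_nonpos_of_nonneg_of_nonpos (mul_nonneg ?_ (pow_nonneg hq.le _)) i₂) <;>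
    split_ifs <;> norm_num


end Series

end FK

end Summit.CriticalPhenomena.PercolationContinuityZ3.Theorems

end
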